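import Mathlib
import HarnessLib
import HarnessLib.Audit
import Summits.QuantumAdvantage.Statement
import Literature.Computability.Cryptography.ClassBQP
import Literature.Computability.Complexity.Randomized
import Literature.Computability.Complexity.BPPErrorReduction
import Literature.Computability.Complexity.BoolEncodings
import Literature.Computability.Complexity.ConstantDepth
import Literature.Probability.RandomGraphs.LowDegree
import HarnessLib.Audit.Status.Attr

/-!
Route: WeilTwice

DORMANT since 2026-08-23T14:39:37Z (reconciler: no traction for 6 d (last activity item-evidence-added at 2026-08-17T12:41:12Z); parked, not closed — `ledger route dormant route-QuantumAdvantage-WeilTwice --off` to reactivate) — unstaffed, not closed; items shared with open routes are served there. `ledger route dormant <id> --off` reactivates.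

# Route WeilTwice — Weil twice — the function-field transfer of the arithmetic-statistics ladder
(Kedlaya membership, Deligne unpredictability) for 3 ∣ #J

OPERATOR B (adjacent-transfer). The adjacent SOLVED case of the arithmetic cluster of this summit is
the FUNCTION FIELD: over 𝔽_p(t) the
Riemann hypothesis is Weil's theorem. Transfer route ArithStatLadder (IQ3 = 3 ∣ h(−d): membership
needs GRH-free class-group generation,
the rungs need Davenport–Heilbronn on minor arcs, the prior 0.44 is Cohen–Lenstra's OPEN conjecture)
to the universal one-parameter
hyperelliptic family C_{h,u} : y² = h(x)(x − u) over 𝔽_p, p an n-bit prime, deg h = 2g, g = ⌊√n⌋/3,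
witness bit "3 ∣ #J(C_{h,u})(𝔽_p)"
(#J = the number of Mumford pairs (a, b), a monic, deg b < deg a ≤ g, a ∣ b² − h(x)(x−u): an
ELEMENTARY count, no algebraic geometry in
the statement). It suffices to show X = X_Q ∧ X_P ∧ X_H: X_Q (JacThreeMemBQP) the witness language
L3 is in BQP — Kedlaya's theorem,
UNCONDITIONAL because the Hasse–Weil box is Weil's theorem; X_P (PriorBand) for all large n the
density of YES instances lies in
[0.19, 0.51] — a THEOREM here (Chebotarev in GSp_2g(𝔽₃) by Yu/Hall big monodromy + Deligne +
Grothendieck–Ogg–Shafarevich on a curve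
base, uniform in g, plus two Burnside/Witt orbit moments E[3^d] = 2, E[9^d] ∈ {6, 8}), where its
number-field analogue is open; X_H
(BeyondMajority, hypothesis-type crux, ranked last) no PPT predicts the bit better than the majority
rule by 1 % at all large levels. The
deciding theorem `closes : JacThreeMemBQP → PriorBand → BeyondMajority → QuantumAdvantage`
(kernel-checked, Sketch2.lean rc 0) USES
X_P: unpredictability relative to the prior forces L3 ∉ BPP only because the prior is provably
bounded away from 1. Card
bridge-barrier-genus (graded variant as a bare Kedlaya bridge) is absorbed as the instantiation
seed; the transfer content is new.
Lean: `let F : (p : ℕ) → List ℕ → ℕ → Polynomial (ZMod p) := fun p cs u => ((Polynomial.X :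
Polynomial (ZMod p)) ^ cs.length + ∑ i ∈ Finset.range cs.length, Polynomial.C ((cs.getD i 0 : ℕ) :
ZMod p) * Polynomial.X ^ i) * (Polynomial.X - Polynomial.C ((u : ℕ) : ZMod p)); let jac : (p : ℕ) →
ℕ → List ℕ → ℕ → ℕ := fun p g cs u => Nat.card {w : Polynomial (ZMod p) × Polynomial (ZMod p) //
w.1.Monic ∧ w.1.natDegree ≤ g ∧ w.2.degree < w.1.degree ∧ w.1 ∣ w.2 ^ 2 - F p cs u}; let Valid : ℕ ×
List ℕ × ℕ → Prop := fun x => x.1.Prime ∧ 5 ≤ x.1 ∧ x.2.1.length = 2 * (Nat.sqrt x.1.size / 3) ∧ (∀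
c ∈ x.2.1, c < x.1) ∧ x.2.2 < x.1 ∧ Squarefree (F x.1 x.2.1 x.2.2); let enc : ℕ × List ℕ × ℕ → List
Bool := fun x => Literature.Computability.Complexity.boolPair (Computability.encodeNat x.1)
(Literature.Computability.Complexity.boolPair ((x.2.1.map fun c => List.ofFn fun i : Fin x.1.size =>
Nat.testBit c i).flatten) (List.ofFn fun i : Fin x.1.size => Nat.testBit x.2.2 i)); let L3 :
Language Bool := enc '' {x | Valid x ∧ 3 ∣ jac x.1 (Nat.sqrt x.1.size / 3) x.2.1 x.2.2}; let S : ℕ →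
Finset (ℕ × List ℕ × ℕ) := fun n => (((Finset.Ico (2 ^ (n - 1)) (2 ^ n)).filter fun p => p.Prime ∧ 5
≤ p).biUnion fun p => (Finset.univ : Finset ((Fin (2 * (Nat.sqrt n / 3)) → Fin p) × Fin p)).image
fun cu => (p, List.ofFn (fun i => (cu.1 i : ℕ)), (cu.2 : ℕ))).filter Valid; let dens : ℕ → ℝ := fun
n => (((S n).filter fun x => enc x ∈ L3).card : ℝ) / ((S n).card : ℝ); (L3 ∈
Literature.Computability.Cryptography.BQP) ∧ (∃ n₀ : ℕ, ∀ n ≥ n₀, (S n).Nonempty ∧ (1 : ℝ) / 5 - 1 /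
100 ≤ dens n ∧ dens n ≤ 1 / 2 + 1 / 100) ∧ (∀ A : Literature.Computability.Complexity.RandAlg (List
Bool) Bool, A.IsPolyTime id Computability.encodeBool → ∃ᶠ n in Filter.atTop, (∑ x ∈ S n, A.pr id
(enc x) {Set.boolIndicator L3 (enc x)}) / ((S n).card : ℝ) ≤ max (dens n) (1 - dens n) + 1 / 100)`

## Assembly
Pure logic plus one line of real arithmetic (kernel-checked, Sketch2.lean rc 0, no sorry, no
auxiliary declaration): if L3 ∈ BPP,
amplify to pointwise error 1/200 (`exists_randAlg_error_le_of_mem_BPP_holds`), so the level-n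
average correctness is ≥ 0.995 for every
n; PriorBand gives n₀ with S n nonempty and dens n ∈ [0.19, 0.51], hence max(dens, 1 − dens) + 0.01
≤ 0.82 for n ≥ n₀; BeyondMajority
gives such an n with average ≤ 0.82 — contradiction; so ⟨L3, JacThreeMemBQP, ·⟩ witnesses ∃ L ∈ BQP
∖ BPP.

Rationale: WHY THIS LINE. Dictionary (number field ↦ function field): fundamental −d ↦ squarefree h(x)(x−u)
over 𝔽_p; Cl(ℚ(√−d))[3] ↦ J[3](𝔽_p) with its
Frobenius in GSp_2g(𝔽₃) (multiplier p mod 3 replaces the real/imaginary mirror); Hallgren/Bach–GRH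
generation ↦ Kedlaya's Lemma 10
(random effective divisors are uniform on Pic⁰ once deg ≥ 2g − 1, Riemann–Roch; 16g < p^{1/2}) +
Watrous order finding
(arXiv:math/0411623 Thm 1, Lemma 2, 7, 10; Watrous2001; CheungMosca2001; Cantor1987);
Davenport–Heilbronn "T₃ has mean 2" ↦ "Sp_2g(𝔽₃)
is transitive on nonzero vectors" (Burnside: E[#fixed nonzero vectors] = 1, verified by enumerating
Sp₄(𝔽₃): 0.3609 / coset 0.4375,
E[X] = 2, E[X²] = 8 / 6); Cohen–Lenstra's open density ↦ Chebotarev–Deligne (Deligne1980; Kowalski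
arXiv:math/0503714 Thm 6.2 and §8 for
exactly this family, J.-K. Yu / Hall arXiv:math/0608718 big mod-ℓ monodromy, AchterPries
arXiv:math/0608038; Achter
arXiv:math/0602114); DH on minor arcs (the OPEN middle band of DigitRung, Cruxes/DigitRung) ↦
Deligne with an additive twist ψ(ξu)
plus the fact that a binary digit of u ∈ [0, p) is a square wave of Fourier ℓ¹-mass O(log p) on ℤ/p
(checked numerically: mass ≤ 12 at
n = 10, |T| ≤ 3), so EVERY Walsh level ≤ √n is exponentially flat at once (DigitFlat) and the AC⁰
rung follows by the tree's
LMN/Tal machinery (AcZeroRung, as MobiusLadder.AC0Rung_proof). WHAT BREAKS (and the repairing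
cruxes): (1) small characteristic is
classically EASY (p-adic cohomology: Kedlaya 2001, Lauder–Wan, Harvey arXiv:math/0610973 Õ(p^{1/2}))
— so p must be 2^{Ω(n)} (here p
has n bits, g = √n/3, both ℓ-adic Schoof–Pila (log p)^{g^{O(1)}} and 3-division ideals of degree
3^{2g} are 2^{Θ(√n·polylog)},
DobsonGalbraithSmith arXiv:2211.16128 §4.2); (2) then digits are archimedean, not characters:
repaired for AC⁰ by SquareWaveMass, NOT
for parity tests — ParityRung (Boolean-cube Gowers uniformity of trace functions; FKM
arXiv:1211.3282 is the 𝔽_p-additive analogue) is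
the honest open rung; (3) coset bookkeeping p mod 3. Why EASIER than the bare witness form: the
quantum half and the prior are
theorems, so the only conjectural input is the natural cryptographic unpredictability statement,
with a 1 % margin and an i.o.
quantifier, and it is killable by ANY polynomial-time statistic. Imported areas: ℓ-adic cohomology /
monodromy of families (Deligne,
Katz–Sarnak, Kowalski's sieve), computational arithmetic geometry (Kedlaya, Cantor, Pila, Harvey),
Boolean Fourier analysis (LMN/Tal,
in tree). No route of the 38 open / 5 closed uses curves over finite fields, Deligne, or Kedlaya;
Weil bounds appear only ¬-side
(XorDarkCharacters, card costas-thumbtack-maximal-magic).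

RANKED CRUXES. #2 PriorBand (crux) — THE TRANSFERRED THEOREM (load-bearing in `closes`): there is n₀
such that for every n ≥ n₀ the set S n of valid instances ⟨p, h, u⟩ (p an n-bit prime ≥ 5, h monic
squarefree of degree 2⌊√n⌋/3·… = 2g over 𝔽_p given by its coefficient list, u ∈ 𝔽_p with h(u) ≠ 0)
is nonempty and the fraction of instances whose code lies in L3 (3 ∣ #J) is in [1/5 − 1/100, 1/2 +
1/100]. Proof route: LocalPriorBand (per (p,h)) ⇐ TwistedChebotarev at ξ = 0 + SymplecticMoments +
#U ≥ p − 2g, then average (PriorBandOfLocal). [difficulty: L] (why it might fail: Needs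
Chebotarev–Deligne UNIFORM in g = √n/3: error |GSp_2g(𝔽₃)|^{1/2}·2g·√p/(p−2g) with 3^{g²+g/2} ≪ √p
(margin 3^{0.2n}) and tameness of the mod-3 sheaf at the roots of h and at ∞ for p > 2g+1
(Katz–Sarnak via Kowalski §8); the band is Witt orbit counting — safe.) [arXiv:math/0503714,
arXiv:math/0608718, arXiv:math/0608038, arXiv:math/0602114, Deligne1980, KatzSarnak1999]
#3 JacThreeMemBQP (crux) — the witness language L3 = {enc⟨p, h, u⟩ : valid ∧ 3 ∣ #J(y² =
h(x)(x−u))(𝔽_p)} is in the tree's strict BQP (P-uniform Clifford+T, error ≤ 1/3): parse and validate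
(primality via the tree's factoring ∈ FBQP, squarefreeness by gcd), then Kedlaya's algorithm
specialised to the odd-degree Mumford/Cantor model — near-uniform random reduced divisors
(Riemann–Roch, 16g < √p), Watrous/Cheung–Mosca order of the black-box abelian group J(𝔽_p) with
unique encoding, read #J mod 3. A published theorem (arXiv:math/0411623 Thm 1); unconditional
because |#J − p^g| is boxed by Weil. [difficulty: XL] (why it might fail: Safe mathematically; may
fail AS TYPED: abelian HSP over ℤ^r with r = O(g log p) growing inside ONE uniform Clifford+T family
(the tree has only ℤ and ℤ×ℝ period finding), Las Vegas divisor sampling and fixed-width decoding of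
enc, all inside the 1/3 error budget.) [arXiv:math/0411623, Watrous2001, CheungMosca2001,
Cantor1987, arXiv:cs/0101004]
#4 BeyondMajority (crux) — HYPOTHESIS-TYPE CRUX (conjecture-grade; summit strength by
SeparationPrerequisites; refuters first, never a proving target; ranked last so it does not draw
provers): for every probabilistic polynomial-time A (tree RandAlg, IsPolyTime) there are infinitely
many n at which A's average probability of correctly predicting "enc⟨p,h,u⟩ ∈ L3" over the uniform
valid instance of level n is at most max(dens n, 1 − dens n) + 1/100 — no efficient statistic beats
the majority rule by one percent. The exact function-field analogue of
ArithStatLadder.AvgFaceBeyondPrior, typable relative to the prior because PriorBand is a theorem.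
[deps: PriorBand] [difficulty: open-problem] (why it might fail: False iff a PPT statistic of
(p,h,u) predicts 3 ∣ #J(y²=h(x)(x−u)) 1 % better than "never" for all large n: a poly(g, log p)
point count (Kedlaya: "elusive"), a 3-division-ideal method polynomial in g, or an unnoticed
Frobenian/2-torsion correlation (Goursat: none).) [arXiv:math/0411623, arXiv:2211.16128,
arXiv:math/0610973, arXiv:1210.8239, BogdanovTrevisan2006,
Literature.Barriers.QuantumAdvantage.SeparationPrerequisites]
#9 LocalPriorBand (support) — per-family prior: for large n, every n-bit prime p and every h of
degree 2g (g = ⌊√n⌋/3) with nonempty good set U = {u : h(x)(x−u) squarefree}, the fraction of u ∈ U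
with 3 ∣ #J lies in [1/5 − 1/100, 1/2 + 1/100]. From TwistedChebotarev (ξ = 0), SymplecticMoments
and #U ≥ p − 2g. [difficulty: M] [arXiv:math/0503714, arXiv:math/0602114, Deligne1980]
#9 PriorBandOfLocal (support) — glue of the foreseen split: LocalPriorBand → PriorBand (S n is the
disjoint union over (p, h) of the good sets; a weighted average of numbers in the band is in the
band; nonemptiness of S n for n ≥ 3 by Bertrand and h = ∏_{i<2g}(x − i)). [difficulty: provable-now]
[arXiv:math/0503714, BogdanovTrevisan2006]
#9 SymplecticMoments (support) — the group-theoretic core of the prior, PROVABLE NOW by Burnside +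
Witt: for g ≥ 2 and m ∈ {1, 2} ⊂ 𝔽₃, in the coset G_m = {M : M J Mᵀ = m J} of GSp_2g(𝔽₃) the
proportion of M with det(M − 1) = 0 lies in [1/5, 1/2] (E[3^d − 1] = 1 by transitivity on nonzero
vectors; E[(3^d−1)(3^d−3)] = 3 resp. 1 = number of Sp-orbits on independent pairs available in the
coset; Cauchy–Schwarz). Verified exactly for g = 2 by enumeration (0.3609, 0.4375). [difficulty: M]
[arXiv:math/0602114, KatzSarnak1999]
#9 TwistedChebotarev (support) — NAMED-FACT-TYPE (theorem assembled from print: Deligne's Weil II on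
H¹_c of a curve, Grothendieck–Ogg–Shafarevich, Yu/Hall big monodromy, Mumford/Cantor #J = Mumford
count, P(1) mod 3 = charpoly of Frobenius on J[3]): for g ≥ 1, p prime with 3^{2g} < p, every h of
degree 2g and every additive frequency ξ ∈ 𝔽_p, |Σ_{u good} (𝟙[3 ∣ #J_u] − c_{p mod 3}(g)) e(ξu/p)|
≤ 3^{g²+3g+3} √p, where c_m(g) is the eigenvalue-1 proportion in the coset G_m. Derivation: expand
in characters of GSp, h¹_c = 2g·rank (tame at finite punctures, Swan 1 at ∞ from the twist), |Σ_χ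
⟨φ,χ⟩χ(1)| ≤ |G|^{1/2} ≤ 3^{g²+g/2+1}. [difficulty: L] [Deligne1980, arXiv:math/0503714,
arXiv:math/0608718, arXiv:math/0608038, Cantor1987, KatzSarnak1999]
#9 SquareWaveMass (support) — the repair of "digits are not characters", PROVABLE NOW (elementary
harmonic analysis on ℤ/p): for p < 2^n and every set T of bit positions, the ℓ¹ Fourier mass over
ℤ/p of the Walsh function u ↦ ∏_{j∈T} (−1)^{bit_j(u)} is at most (8n)^{|T|+1} (each bit is a square
wave of period 2^{j+1}, mass O(j); products convolve; restriction from ℤ/2^{J+1} to [0, p) costs a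
Dirichlet-kernel factor O(log p)). Numerically the mass is ≈ 6–12 for n = 10, |T| ≤ 3. [difficulty:
provable-now] [LinialMansourNisan1993, Green2012]
#9 DigitFlat (support) — R1, the rung that is OPEN for class groups (DigitRung middle band) and a
theorem here: for large n, every n-bit prime p, every h, and every Walsh character of at most √n
digit positions of u, the centred indicator of 3 ∣ #J over the good set has correlation ≤ p·2^{−n/8}
(TwistedChebotarev for all ξ + SquareWaveMass; budget 2^{0.5n + 0.18n + o(n)} against p·2^{−n/8} ≥
2^{0.87n}). [difficulty: M] [Deligne1980, arXiv:math/0503714, LinialMansourNisan1993,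
arXiv:1211.3282]
#9 FrobOrthogonalAC0 (support) — R2 statement: the centred indicator of 3 ∣ #J along u is
o(p)-correlated with every polynomial-size constant-depth AC⁰ circuit reading the n bits of u
(uniformly over n-bit p and h). [difficulty: M] [LinialMansourNisan1993, Tal2017, Green2012]
#9 AcZeroRung (support) — R1 ⇒ R2, PROVABLE NOW with the tree's machinery exactly as
MobiusLadder.AC0Rung_proof: low levels |S| ≤ K by `Circuit.l1Level_acBasis_le` times the 2^{−n/8}
flatness, high levels by `ACForm.tailWeight_le_tailBound`; K = polylog(n) ≤ √n. [difficulty: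
provable-now] [LinialMansourNisan1993, Tal2017, Green2012]
#9 JacThreeNotAC0 (support) — class glue: FrobOrthogonalAC0 → LocalPriorBand → L3 ∉ AC0 (restrict a
deciding circuit family to fixed (p, h): the fixed-width encoding makes all level-n instances
equal-length; a decider has correlation 2·dens(1−dens)·#U ≥ 0.3·#U with the centred indicator,
contradicting o(p)). [difficulty: M] [LinialMansourNisan1993, Green2012]
#9 ParityRung (support) — R3, the honest OPEN rung created by the transfer ("what breaks" (2)): the
centred indicator of 3 ∣ #J along u is o(p)-correlated with (−1)^P for every 𝔽₂-polynomial P of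
bounded degree in the BITS of u — Gowers uniformity of a trace function with respect to the
BOOLEAN-CUBE structure of binary digits (XOR-shifts are not field operations for odd p; FKM
arXiv:1211.3282 proves the 𝔽_p-additive version). With Razborov–Smolensky it would give L3 ∉ AC⁰[⊕].
[difficulty: open-problem] [arXiv:1211.3282, Razborov1987, Smolensky1987]

TWO-LAYER PLAN. PriorBand ⇐ LocalPriorBand → PriorBandOfLocal-glue → PriorBand, and LocalPriorBand ⇐
TwistedChebotarev → SymplecticMoments → LocalPriorBand
(k = 2, depth 1; filed as supports now so idle provers can take them). JacThreeMemBQP ⇐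
(JacOrderFBQP: ⟨p,h,u⟩ ↦ #J ∈ FBQP, Kedlaya) →
(classical wrap mod 3 + validation) → JacThreeMemBQP, and JacOrderFBQP ⇐ (abelian-group order with
unique encoding ∈ FBQP, Watrous) →
(Cantor arithmetic + uniform divisor sampling in FP/Las Vegas) — to be split by tenure once a lead
picks the line. DigitFlat ⇐
TwistedChebotarev → SquareWaveMass → DigitFlat.

KILL CRITERIA. (i) A PPT statistic of (p, h, u) beating the majority rule by 1 % on 3 ∣ #J for all
large n — in particular any poly(g, log p)
point-counting algorithm, or a polynomial-in-g handle on the 3-division ideal — refutes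
BeyondMajority: close `refuted:BeyondMajority`
(the earned theorems PriorBand/DigitFlat/AcZeroRung survive as Literature-grade facts about the
family). (ii) PriorBand refuted AS TYPED
(constant 3^{g²+3g+3} or the band wrong for some g) is a misstated-class repair: lower g(n) to
n^{1/4} or widen the band (the
deciding theorem only needs dens ≤ 0.98); a SUBSTANTIVE failure of equidistribution mod 3 in Yu's
family would contradict Hall 2008 —
not expected. (iii) A decider-black-box reduction of 3 ∣ #J to FACTORING/DLOG makes the route a Shor
sibling (still informative; card
bridge-barrier-genus' bridge barrier says the hypothesis is of the only admissible, quantum-broken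
kind). (iv) BQP ⊆ BPP proved (¬summit)
refutes BeyondMajority via closes' contrapositive.

NOT DECOMPOSED YET. The FBQP function form and its weakest hypothesis "⟨p,h,u⟩ ↦ #J ∉ FBPP" (shape
W: all bits of #J in BQP + bits-to-function plumbing;
strictly weaker hypothesis, no prior needed, but then nothing transferred is load-bearing — kept as
the fallback deciding shape);
the AC⁰[⊕] class glue from ParityRung (Razborov–Smolensky, as MobiusLadder.LiouvilleNotAC0Xor); a
TC⁰/genericity rung ("every GENERIC
𝔽_p-algorithm deciding 3 ∣ #J uses ≥ 3^{cg} operations": ℓ-adic is generic, p-adic is not — a lower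
bound of a new kind, not typed);
explicit n₀ and the exact limiting densities c_±(g) (Fulman-type cycle indices); the general-f (2g+1
free coefficients) family, where
only the p^{1/2}-saving H^{2N}_c-vanishing form of Deligne is available and Katz's Betti bounds
2^{O(g² log g)} force g ≤ n^{1/3}.

CHEAPEST FALSIFIER. For the transfer's theorem side, three checks I RAN (gen/*.py, local, seconds):
(a) enumerate Sp₄(𝔽₃) (51 840 elements): eigenvalue-1
proportion 0.3609, E[X] = 2, E[X²] = 8; multiplier-2 coset 0.4375, E[X] = 2, E[X²] = 6 — exactly the
orbit-count predictions behind
SymplecticMoments, inside [1/5, 1/2]; (b) the g = 1 family y² = (x²+ax+b)(x−u) at p = 1999 ≡ 1 (3) /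
2003 ≡ 2 (3): densities
0.372–0.378 / 0.4993–0.4998 against the Chebotarev predictions 9/24 = 0.375 / 12/24 = 0.5; (c) the
Mumford-pair count equals
(N₁² + N₂)/2 − p for g = 2 at p = 11, 13 (definition check); (d) square-wave ℓ¹ masses ≤ 12.2 for n
= 10, |T| ≤ 3 (bound (8n)^{|T|+1}).
For the hypothesis: run the 2-torsion/factorisation-pattern predictor and the "p mod 3, u mod small
primes" predictors on g = 2,
p ≈ 2^16 (one kit job; Goursat predicts zero advantage) — the refuter's first probe; and the
literature lookup "is #J mod 3 of a genus-g
hyperelliptic curve computable in time poly(g, log p)?" (DGS 2022 §4.2: no; degree of the 3-division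
ideal is 3^{2g}).

NUMBERS. g(n) = ⌊√n⌋/3; p ∈ [2^{n−1}, 2^n); |GSp_2g(𝔽₃)| ≤ 2·3^{2g²+g}; Chebotarev error ≤
3^{g²+3g+3}√p (relative ≤ 2^{−0.3n}); prior band
[0.19, 0.51] (limits: Sp 0.3609 at g = 2, 1 − ∏(1+3^{−i})^{−1} ≈ 0.361 as g → ∞; coset 0.4375 at g =
2); DigitFlat: levels ≤ √n, decay
2^{−n/8}; classical attacks: p-adic Õ(p^{1/2}) = 2^{n/2} (Harvey), ℓ-adic (log p)^{O(g² log g)} =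
2^{O(n^{1.5}·…)}… for g = √n/3 this
is 2^{Θ(n log² n /9)} (Adleman–Huang), 3-division ideal degree 3^{2g} = 2^{1.06√n}; Kedlaya quantum
poly(g, log p) with 16g < p^{1/2}.
Items at open: 14 (3 cruxes incl. the hypothesis-type BeyondMajority, 1 assembly, 10 supports).

DEFINITION REQUESTS. None blocking: the Mumford count, the family and the encoding are inlined
(elementary). Wanted later as Literature definitions (to
shorten the decls): `Literature.NumberTheory.FunctionFields.Hyperelliptic.mumfordCount` (= #Pic⁰ for
odd-degree models, Cantor1987),
and a named fact `kedlaya2006_jacobianOrder_FBQP`. Cite items wanted: Hall 2008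
(doi:10.1215/00127094-2008-002), Kowalski 2006
(doi:10.1515/CRELLE.2006.094), Kedlaya 2006 (doi:10.1007/s00037-006-0204-7), Achter 2006
(arXiv:math/0602114), DGS 2022 (arXiv:2211.16128).

Novelty: Searches (2026-08-16): hub — read all 38 open + 5 closed route headers' levers (none uses curves
over finite fields / Deligne / Kedlaya;
Weil bounds only ¬-side in XorDarkCharacters), grep of Ideas/ (30 cards) and Theses/ for
kedlaya|hyperelliptic|zeta|point count|function
field|Deligne|Weil|Chebotarev: hits = card bridge-barrier-genus (Kedlaya X_E seed, graded VARIANT as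
"Shor template with Kedlaya
substituted", refuter-novelty-audit-5) and card costas-thumbtack-maximal-magic (Weil bound, ¬-side),
heights-obstruct-index-calculus
(ECDLP/generic group), cubic-thue, linking-not-braiding, pigeonhole-solvent (mentions "Kedlaya
orders" in a TFNP list); `ledger negatives
--problem QuantumAdvantage` (6; none near); `lit frontier QuantumAdvantage --since 2021` (30 rows:
certified randomness, shallow Toffoli,
IQP 2-Forrelation, p-class groups of real quadratic fields arXiv:2601.19288 — nothing on zeta/point
counting); `lit bridges QuantumAdvantage
--cross any` (30 rows, generic); `lit search --source arxiv` ×14 queries (quantum zeta Kedlaya →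
math/0411623; trustless unknown-order →
2211.16128; Kowalski large sieve → math/0503714, 0807.2118, 1703.06965; Hall → math/0608718;
Achter–Pries → math/0608038; Achter →
math/0602114; FKM Gowers trace functions → 1211.3282; Cheung–Mosca → cs/0101004; EVW → 0912.0325;
Harvey → math/0610973, 1210.8239;
"hyperelliptic genus 3 unknown order", "Mauduit Sarkozy Legendre pseudorandom", "Katz Betti" → 0
arXiv rows); `lit galaxy search
"quantum computati  [refs: 2601.19288, math/0411623, 2211.16128, math/0503714, math/0608718, math/0602114]

Barriers (technique_class: adjacent-transfer, arithmetic-geometry, correlation-bounds): - technique_class: adjacent-transfer, arithmetic-geometry, correlation-bounds (also: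
ell-adic-monodromy, average-case, quantum-algorithm)
- Literature.Barriers.QuantumAdvantage.SeparationPrerequisites: APPLIES and is CONFINED to the
hypothesis-type crux BeyondMajority (with JacThreeMemBQP it yields BQP ⊄ BPP, and since 3 ∣ #J has
NP certificates — a Mumford pair of order 3 — also NP ⊄ BPP); nothing else in the route is
separation-strength: PriorBand, DigitFlat, AcZeroRung, SquareWaveMass, SymplecticMoments are
theorems of arithmetic geometry / harmonic analysis, JacThreeMemBQP a published algorithm.
- Literature.Barriers.QuantumAdvantage.Relativization: not engaged by the earned content
(restricted-model and statistical theorems about an explicit family); the conditional step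
BeyondMajority → L3 ∉ BPP is a hypothesis, not a relativizing proof; the membership proof is
white-box arithmetic (Cantor's group law on explicit Mumford pairs).
- Literature.Barriers.QuantumAdvantage.Algebrization: same — no arithmetization/sum-check ingredient
anywhere.
- Literature.Barriers.QuantumAdvantage.NaturalProofs: NOT engaged: the rungs stop at AC⁰ / digit
classes (no pseudorandom functions there) and claim no P/poly bound; the property used ("correlates
with Frobenius mod 3 of J(y² = h(x)(x−u))") is not constructive without the point counts (themselves
the hard function), hence non-natural in Razborov–Rudich's sense.
- Total-function speedup limit (catalogue QA-A09, `TotalFunctionSpeedupLimit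

History (route lifecycle, newest last):
- 2026-08-23T14:39:37Z · DORMANT — reconciler: no traction for 6 d (last activity item-evidence-added at 2026-08-17T12:41:12Z); parked, not closed — `ledger route dormant route-QuantumAdvantage-W (operator:999:1191648)

sub-problem: QuantumAdvantage · status: dormant · opened planner-plan-novel-QuantumAdvantage-QuantumAdva-e0108269-b-v2-g7-0 2026-08-16T19:27:12Z · rev 1 · ledger route-QuantumAdvantage-WeilTwice
GENERATED by the gate from the ledger (D-0016/17). Provers cite these decls: `theorem foo : Summit.QuantumAdvantage.QuantumAdvantage.Theses.WeilTwice.<Decl> := …` in Summits/QuantumAdvantage/QuantumAdvantage/Theorems/<Name>.lean.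
-/

namespace Summit.QuantumAdvantage.QuantumAdvantage.Theses.WeilTwice

open scoped BigOperators Topology Manifold Classical MeasureTheory ProbabilityTheory Matrix InnerProductSpace ComplexConjugate ContinuousMap
open Filter Set Function TopologicalSpace MeasureTheory

attribute [summit_statement] _root_.QuantumAdvantage

open Literature.QuantumAdvantage

/-- item stmt-QuantumAdvantage-16536 · crux · rank 2 · open · by planner
why it might fail: Needs Chebotarev–Deligne UNIFORM in g = √n/3: error |GSp_2g(𝔽₃)|^{1/2}·2g·√p/(p−2g) with 3^{g²+g/2} ≪ √p (margin 3^{0.2n}) and tameness of the mod-3 sheaf at the roots of h and at ∞ for p > 2g+1 (Katz–Sarnak via Kowalski §8); the band is Witt orbit counting — safe.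
sources: arXiv:math/0503714, arXiv:math/0608718, arXiv:math/0608038, arXiv:math/0602114, Deligne1980, KatzSarnak1999
[crux] THE TRANSFERRED THEOREM (load-bearing in `closes`): there is n₀ such that for every n ≥ n₀
the set S n of valid instances ⟨p, h, u⟩ (p an n-bit prime ≥ 5, h monic squarefree of degree
2⌊√n⌋/3·… = 2g over 𝔽_p given by its coefficient list, u ∈ 𝔽_p with h(u) ≠ 0) is nonempty and the
fraction of instances whose code lies in L3 (3 ∣ #J) is in [1/5 − 1/100, 1/2 + 1/100]. Proof route:
LocalPriorBand (per (p,h)) ⇐ TwistedChebotarev at ξ = 0 + SymplecticMoments + #U ≥ p − 2g, then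
average (PriorBandOfLocal). [difficulty: L] -/
@[route_item "route-QuantumAdvantage-WeilTwice", crux]
def PriorBand : Prop :=
  let F : (p : ℕ) → List ℕ → ℕ → Polynomial (ZMod p) := fun p cs u => ((Polynomial.X : Polynomial (ZMod p)) ^ cs.length + ∑ i ∈ Finset.range cs.length, Polynomial.C ((cs.getD i 0 : ℕ) : ZMod p) * Polynomial.X ^ i) * (Polynomial.X - Polynomial.C ((u : ℕ) : ZMod p)); let jac : (p : ℕ) → ℕ → List ℕ → ℕ → ℕ := fun p g cs u => Nat.card {w : Polynomial (ZMod p) × Polynomial (ZMod p) // w.1.Monic ∧ w.1.natDegree ≤ g ∧ w.2.degree < w.1.degree ∧ w.1 ∣ w.2 ^ 2 - F p cs u}; let Valid : ℕ × List ℕ × ℕ → Prop := fun x => x.1.Prime ∧ 5 ≤ x.1 ∧ x.2.1.length = 2 * (Nat.sqrt x.1.size / 3) ∧ (∀ c ∈ x.2.1, c < x.1) ∧ x.2.2 < x.1 ∧ Squarefree (F x.1 x.2.1 x.2.2); let enc : ℕ × List ℕ × ℕ → List Bool := fun x => Literature.Computability.Complexity.boolPair (Computability.encodeNat x.1) (Literature.Computability.Complexity.boolPair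 ((x.2.1.map fun c => List.ofFn fun i : Fin x.1.size => Nat.testBit c i).flatten) (List.ofFn fun i : Fin x.1.size => Nat.testBit x.2.2 i)); let L3 : Language Bool := enc '' {x | Valid x ∧ 3 ∣ jac x.1 (Nat.sqrt x.1.size / 3) x.2.1 x.2.2}; let S : ℕ → Finset (ℕ × List ℕ × ℕ) := fun n => (((Finset.Ico (2 ^ (n - 1)) (2 ^ n)).filter fun p => p.Prime ∧ 5 ≤ p).biUnion fun p => (Finset.univ : Finset ((Fin (2 * (Nat.sqrt n / 3)) → Fin p) × Fin p)).image fun cu => (p, List.ofFn (fun i => (cu.1 i : ℕ)), (cu.2 : ℕ))).filter Valid; let dens : ℕ → ℝ := fun n => (((S n).filter fun x => enc x ∈ L3).card : ℝ) / ((S n).card : ℝ); ∃ n₀ : ℕ, ∀ n ≥ n₀, (S n).Nonempty ∧ (1 : ℝ) / 5 - 1 / 100 ≤ dens n ∧ dens n ≤ 1 / 2 + 1 / 100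

/-- item stmt-QuantumAdvantage-16537 · crux · rank 3 · open · by planner
why it might fail: Safe mathematically; may fail AS TYPED: abelian HSP over ℤ^r with r = O(g log p) growing inside ONE uniform Clifford+T family (the tree has only ℤ and ℤ×ℝ period finding), Las Vegas divisor sampling and fixed-width decoding of enc, all inside the 1/3 error budget.
sources: arXiv:math/0411623, Watrous2001, CheungMosca2001, Cantor1987, arXiv:cs/0101004
[crux] the witness language L3 = {enc⟨p, h, u⟩ : valid ∧ 3 ∣ #J(y² = h(x)(x−u))(𝔽_p)} is in the
tree's strict BQP (P-uniform Clifford+T, error ≤ 1/3): parse and validate (primality via the tree's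
factoring ∈ FBQP, squarefreeness by gcd), then Kedlaya's algorithm specialised to the odd-degree
Mumford/Cantor model — near-uniform random reduced divisors (Riemann–Roch, 16g < √p),
Watrous/Cheung–Mosca order of the black-box abelian group J(𝔽_p) with unique encoding, read #J mod
3. A published theorem (arXiv:math/0411623 Thm 1); unconditional because |#J − p^g| is boxed by
Weil. [difficulty: XL] -/
@[route_item "route-QuantumAdvantage-WeilTwice", crux]
def JacThreeMemBQP : Prop :=
  let F : (p : ℕ) → List ℕ → ℕ → Polynomial (ZMod p) := fun p cs u => ((Polynomial.X : Polynomial (ZMod p)) ^ cs.length + ∑ i ∈ Finset.range cs.length, Polynomial.C ((cs.getD i 0 : ℕ) : ZMod p) * Polynomial.X ^ i) * (Polynomial.X - Polynomial.C ((u : ℕ) : ZMod p)); let jac : (p : ℕ) → ℕ → List ℕ → ℕ → ℕ := fun p g cs u => Nat.card {w : Polynomial (ZMod p) × Polynomial (ZMod p) // w.1.Monic ∧ w.1.natDegree ≤ g ∧ w.2.degree < w.1.degree ∧ w.1 ∣ w.2 ^ 2 - F p cs u}; let Valid : ℕ × List ℕ × ℕ → Prop := fun x => x.1.Prime ∧ 5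 ≤ x.1 ∧ x.2.1.length = 2 * (Nat.sqrt x.1.size / 3) ∧ (∀ c ∈ x.2.1, c < x.1) ∧ x.2.2 < x.1 ∧ Squarefree (F x.1 x.2.1 x.2.2); let enc : ℕ × List ℕ × ℕ → List Bool := fun x => Literature.Computability.Complexity.boolPair (Computability.encodeNat x.1) (Literature.Computability.Complexity.boolPair ((x.2.1.map fun c => List.ofFn fun i : Fin x.1.size => Nat.testBit c i).flatten) (List.ofFn fun i : Fin x.1.size => Nat.testBit x.2.2 i)); let L3 : Language Bool := enc '' {x | Valid x ∧ 3 ∣ jac x.1 (Nat.sqrt x.1.size / 3) x.2.1 x.2.2}; L3 ∈ Literature.Computability.Cryptography.BQP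

/-- item stmt-QuantumAdvantage-16538 · crux · rank 4 · open · by planner
why it might fail: False iff a PPT statistic of (p,h,u) predicts 3 ∣ #J(y²=h(x)(x−u)) 1 % better than "never" for all large n: a poly(g, log p) point count (Kedlaya: "elusive"), a 3-division-ideal method polynomial in g, or an unnoticed Frobenian/2-torsion correlation (Goursat: none).
sources: arXiv:math/0411623, arXiv:2211.16128, arXiv:math/0610973, arXiv:1210.8239, BogdanovTrevisan2006, Literature.Barriers.QuantumAdvantage.SeparationPrerequisites
[crux] HYPOTHESIS-TYPE CRUX (conjecture-grade; summit strength by SeparationPrerequisites; refuters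
first, never a proving target; ranked last so it does not draw provers): for every probabilistic
polynomial-time A (tree RandAlg, IsPolyTime) there are infinitely many n at which A's average
probability of correctly predicting "enc⟨p,h,u⟩ ∈ L3" over the uniform valid instance of level n is
at most max(dens n, 1 − dens n) + 1/100 — no efficient statistic beats the majority rule by one
percent. The exact function-field analogue of ArithStatLadder.AvgFaceBeyondPrior, typable relative
to the prior because PriorBand is a theorem. [deps: PriorBand] [difficulty: open-problem] -/
@[route_item "route-QuantumAdvantage-WeilTwice", crux]
def BeyondMajority : Prop :=
  let F : (p : ℕ) → List ℕ → ℕ → Polynomial (ZMod p) := fun p cs u => ((Polynomial.X : Polynomial (ZMod p)) ^ cs.length + ∑ i ∈ Finset.range cs.length, Polynomial.C ((cs.getD i 0 : ℕ) : ZMod p) * Polynomial.X ^ i) * (Polynomial.X - Polynomial.C ((u : ℕ) : ZMod p)); let jac : (p : ℕ) → ℕ → List ℕ → ℕ → ℕ := fun p g cs u => Nat.card {w : Polynomial (ZMod p) × Polynomial (ZMod p) // w.1.Monic ∧ w.1.natDegree ≤ g ∧ w.2.degree < w.1.degree ∧ w.1 ∣ w.2 ^ 2 - F p cs u}; let Valid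 : ℕ × List ℕ × ℕ → Prop := fun x => x.1.Prime ∧ 5 ≤ x.1 ∧ x.2.1.length = 2 * (Nat.sqrt x.1.size / 3) ∧ (∀ c ∈ x.2.1, c < x.1) ∧ x.2.2 < x.1 ∧ Squarefree (F x.1 x.2.1 x.2.2); let enc : ℕ × List ℕ × ℕ → List Bool := fun x => Literature.Computability.Complexity.boolPair (Computability.encodeNat x.1) (Literature.Computability.Complexity.boolPair ((x.2.1.map fun c => List.ofFn fun i : Fin x.1.size => Nat.testBit c i).flatten) (List.ofFn fun i : Fin x.1.size => Nat.testBit x.2.2 i)); let L3 : Language Bool := enc '' {x | Valid x ∧ 3 ∣ jac x.1 (Nat.sqrt x.1.size / 3) x.2.1 x.2.2}; let S : ℕ → Finset (ℕ × List ℕ × ℕ) := fun n => (((Finset.Ico (2 ^ (n - 1)) (2 ^ n)).filter fun p => p.Prime ∧ 5 ≤ p).biUnion fun p => (Finset.univ : Finset ((Fin (2 * (Nat.sqrt n / 3)) → Fin p) × Fin p)).image fun cu => (p, List.ofFn (fun i => (cu.1 i : ℕ)), (cu.2 : ℕ))).filter Valid; let dens : ℕ → ℝ := fun n => (((S n).filter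 fun x => enc x ∈ L3).card : ℝ) / ((S n).card : ℝ); ∀ A : Literature.Computability.Complexity.RandAlg (List Bool) Bool, A.IsPolyTime id Computability.encodeBool → ∃ᶠ n in Filter.atTop, (∑ x ∈ S n, A.pr id (enc x) {Set.boolIndicator L3 (enc x)}) / ((S n).card : ℝ) ≤ max (dens n) (1 - dens n) + 1 / 100

/-- item stmt-QuantumAdvantage-16539 · support · rank 9 · open · by planner
sources: arXiv:math/0503714, arXiv:math/0602114, Deligne1980
[support] per-family prior: for large n, every n-bit prime p and every h of degree 2g (g = ⌊√n⌋/3)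
with nonempty good set U = {u : h(x)(x−u) squarefree}, the fraction of u ∈ U with 3 ∣ #J lies in
[1/5 − 1/100, 1/2 + 1/100]. From TwistedChebotarev (ξ = 0), SymplecticMoments and #U ≥ p − 2g.
[difficulty: M] -/
@[route_item "route-QuantumAdvantage-WeilTwice"]
def LocalPriorBand : Prop :=
  let F : (p : ℕ) → List ℕ → ℕ → Polynomial (ZMod p) := fun p cs u => ((Polynomial.X : Polynomial (ZMod p)) ^ cs.length + ∑ i ∈ Finset.range cs.length, Polynomial.C ((cs.getD i 0 : ℕ) : ZMod p) * Polynomial.X ^ i) * (Polynomial.X - Polynomial.C ((u : ℕ) : ZMod p)); let jac : (p : ℕ) → ℕ → List ℕ → ℕ → ℕ := fun p g cs u => Nat.card {w : Polynomial (ZMod p) × Polynomial (ZMod p) // w.1.Monic ∧ w.1.natDegree ≤ g ∧ w.2.degree < w.1.degree ∧ w.1 ∣ w.2 ^ 2 - F p cs u}; let good : (p g : ℕ) → (Fin (2 * g) → Fin p) → Finset (Fin p) := fun p g c => Finset.univ.filter fun u : Fin p => Squarefree (F p (List.ofFn fun i => (c i : ℕ)) u); let ind : (p g : ℕ) → (Fin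 (2 * g) → Fin p) → Fin p → ℝ := fun p g c u => if 3 ∣ jac p g (List.ofFn fun i => (c i : ℕ)) u then 1 else 0; let dL : (p g : ℕ) → (Fin (2 * g) → Fin p) → ℝ := fun p g c => (∑ u ∈ good p g c, ind p g c u) / ((good p g c).card : ℝ); ∃ n₀ : ℕ, ∀ n ≥ n₀, ∀ p : ℕ, p.Prime → p.size = n → ∀ c : Fin (2 * (Nat.sqrt n / 3)) → Fin p, (good p (Nat.sqrt n / 3) c).Nonempty → (1 : ℝ) / 5 - 1 / 100 ≤ dL p (Nat.sqrt n / 3) c ∧ dL p (Nat.sqrt n / 3) c ≤ 1 / 2 + 1 / 100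

/-- item stmt-QuantumAdvantage-16540 · support · rank 9 · open · by planner
sources: arXiv:math/0503714, BogdanovTrevisan2006
[support] glue of the foreseen split: LocalPriorBand → PriorBand (S n is the disjoint union over (p,
h) of the good sets; a weighted average of numbers in the band is in the band; nonemptiness of S n
for n ≥ 3 by Bertrand and h = ∏_{i<2g}(x − i)). [difficulty: provable-now] -/
@[route_item "route-QuantumAdvantage-WeilTwice"]
def PriorBandOfLocal : Prop :=
  LocalPriorBand → PriorBand

/-- item stmt-QuantumAdvantage-16541 · support · rank 9 · open · by planner
sources: arXiv:math/0602114, KatzSarnak1999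
[support] the group-theoretic core of the prior, PROVABLE NOW by Burnside + Witt: for g ≥ 2 and m ∈
{1, 2} ⊂ 𝔽₃, in the coset G_m = {M : M J Mᵀ = m J} of GSp_2g(𝔽₃) the proportion of M with det(M − 1)
= 0 lies in [1/5, 1/2] (E[3^d − 1] = 1 by transitivity on nonzero vectors; E[(3^d−1)(3^d−3)] = 3
resp. 1 = number of Sp-orbits on independent pairs available in the coset; Cauchy–Schwarz). Verified
exactly for g = 2 by enumeration (0.3609, 0.4375). [difficulty: M] -/
@[route_item "route-QuantumAdvantage-WeilTwice"]
def SymplecticMoments : Prop :=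
  ∀ g : ℕ, 2 ≤ g → ∀ m : ZMod 3, m ≠ 0 → Nat.card {M : Matrix (Fin g ⊕ Fin g) (Fin g ⊕ Fin g) (ZMod 3) // M * Matrix.J (Fin g) (ZMod 3) * M.transpose = m • Matrix.J (Fin g) (ZMod 3)} ≤ 5 * Nat.card {M : Matrix (Fin g ⊕ Fin g) (Fin g ⊕ Fin g) (ZMod 3) // M * Matrix.J (Fin g) (ZMod 3) * M.transpose = m • Matrix.J (Fin g) (ZMod 3) ∧ (M - 1).det = 0} ∧ 2 * Nat.card {M : Matrix (Fin g ⊕ Fin g) (Fin g ⊕ Fin g) (ZMod 3) // M * Matrix.J (Fin g) (ZMod 3) * M.transpose = m • Matrix.J (Fin g) (ZMod 3) ∧ (M - 1).det = 0} ≤ Nat.card {M : Matrix (Fin g ⊕ Fin g) (Fin g ⊕ Fin g) (ZMod 3) // M * Matrix.J (Fin g) (ZMod 3) * M.transpose = m • Matrix.J (Fin g) (ZMod 3)}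

/-- item stmt-QuantumAdvantage-16542 · support · rank 9 · open · by planner
sources: Deligne1980, arXiv:math/0503714, arXiv:math/0608718, arXiv:math/0608038, Cantor1987, KatzSarnak1999
[support] NAMED-FACT-TYPE (theorem assembled from print: Deligne's Weil II on H¹_c of a curve,
Grothendieck–Ogg–Shafarevich, Yu/Hall big monodromy, Mumford/Cantor #J = Mumford count, P(1) mod 3 =
charpoly of Frobenius on J[3]): for g ≥ 1, p prime with 3^{2g} < p, every h of degree 2g and every
additive frequency ξ ∈ 𝔽_p, |Σ_{u good} (𝟙[3 ∣ #J_u] − c_{p mod 3}(g)) e(ξu/p)| ≤ 3^{g²+3g+3} √p,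
where c_m(g) is the eigenvalue-1 proportion in the coset G_m. Derivation: expand in characters of
GSp, h¹_c = 2g·rank (tame at finite punctures, Swan 1 at ∞ from the twist), |Σ_χ ⟨φ,χ⟩χ(1)| ≤
|G|^{1/2} ≤ 3^{g²+g/2+1}. [difficulty: L] -/
@[route_item "route-QuantumAdvantage-WeilTwice"]
def TwistedChebotarev : Prop :=
  let F : (p : ℕ) → List ℕ → ℕ → Polynomial (ZMod p) := fun p cs u => ((Polynomial.X : Polynomial (ZMod p)) ^ cs.length + ∑ i ∈ Finset.range cs.length, Polynomial.C ((cs.getD i 0 : ℕ) : ZMod p) * Polynomial.X ^ i) * (Polynomial.X - Polynomial.C ((u : ℕ) : ZMod p)); let jac : (p : ℕ) → ℕ → List ℕ → ℕ → ℕ := fun p g cs u => Nat.card {w : Polynomial (ZMod p) × Polynomial (ZMod p) // w.1.Monic ∧ w.1.natDegree ≤ g ∧ w.2.degree < w.1.degree ∧ w.1 ∣ w.2 ^ 2 - F p cs u}; let good : (p g : ℕ) → (Fin (2 * g) → Fin p) → Finset (Fin p) := fun p g c => Finset.univ.filter fun u : Fin p => Squarefree (F p (List.ofFn fun i => (c i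 : ℕ)) u); let ind : (p g : ℕ) → (Fin (2 * g) → Fin p) → Fin p → ℝ := fun p g c u => if 3 ∣ jac p g (List.ofFn fun i => (c i : ℕ)) u then 1 else 0; let dL : (p g : ℕ) → (Fin (2 * g) → Fin p) → ℝ := fun p g c => (∑ u ∈ good p g c, ind p g c u) / ((good p g c).card : ℝ); ∀ g : ℕ, 1 ≤ g → ∀ p : ℕ, p.Prime → 3 ^ (2 * g) < p → ∀ c : Fin (2 * g) → Fin p, ∀ ξ : Fin p, ‖∑ u ∈ good p g c, ((ind p g c u : ℂ) - ((Nat.card {M : Matrix (Fin g ⊕ Fin g) (Fin g ⊕ Fin g) (ZMod 3) // M * Matrix.J (Fin g) (ZMod 3) * M.transpose = (p : ZMod 3) • Matrix.J (Fin g) (ZMod 3) ∧ (M - 1).det = 0} : ℂ) / (Nat.card {M : Matrix (Fin g ⊕ Fin g) (Fin g ⊕ Fin g) (ZMod 3) // M * Matrix.J (Fin g) (ZMod 3) * M.transpose = (p : ZMod 3) • Matrix.J (Fin g) (ZMod 3)} : ℂ))) * Complex.exp (2 * Real.pi * Complex.I * (ξ : ℕ) * (u : ℕ) / p)‖ ≤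 (3 : ℝ) ^ (g ^ 2 + 3 * g + 3) * Real.sqrt p

/-- item stmt-QuantumAdvantage-16543 · support · rank 9 · open · by planner
sources: LinialMansourNisan1993, Green2012
[support] the repair of "digits are not characters", PROVABLE NOW (elementary harmonic analysis on
ℤ/p): for p < 2^n and every set T of bit positions, the ℓ¹ Fourier mass over ℤ/p of the Walsh
function u ↦ ∏_{j∈T} (−1)^{bit_j(u)} is at most (8n)^{|T|+1} (each bit is a square wave of period
2^{j+1}, mass O(j); products convolve; restriction from ℤ/2^{J+1} to [0, p) costs a Dirichlet-kernel
factor O(log p)). Numerically the mass is ≈ 6–12 for n = 10, |T| ≤ 3. [difficulty: provable-now] -/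
@[route_item "route-QuantumAdvantage-WeilTwice"]
def SquareWaveMass : Prop :=
  ∀ n : ℕ, 1 ≤ n → ∀ p : ℕ, 2 ≤ p → p < 2 ^ n → ∀ T : Finset (Fin n), ∑ ξ : Fin p, ‖∑ u : Fin p, (Literature.Probability.RandomGraphs.LowDegree.walsh T (fun i : Fin n => Nat.testBit (u : ℕ) i) : ℂ) * Complex.exp (-(2 * Real.pi * Complex.I * (ξ : ℕ) * (u : ℕ) / p))‖ ≤ (p : ℝ) * (8 * n) ^ (T.card + 1)

/-- item stmt-QuantumAdvantage-16544 · support · rank 9 · open · by planner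
sources: Deligne1980, arXiv:math/0503714, LinialMansourNisan1993, arXiv:1211.3282
[support] R1, the rung that is OPEN for class groups (DigitRung middle band) and a theorem here: for
large n, every n-bit prime p, every h, and every Walsh character of at most √n digit positions of u,
the centred indicator of 3 ∣ #J over the good set has correlation ≤ p·2^{−n/8} (TwistedChebotarev
for all ξ + SquareWaveMass; budget 2^{0.5n + 0.18n + o(n)} against p·2^{−n/8} ≥ 2^{0.87n}).
[difficulty: M] -/
@[route_item "route-QuantumAdvantage-WeilTwice"]
def DigitFlat : Prop :=
  let F : (p : ℕ) → List ℕ → ℕ → Polynomial (ZMod p) := fun p cs u => ((Polynomial.X : Polynomial (ZMod p)) ^ cs.length + ∑ i ∈ Finset.range cs.length, Polynomial.C ((cs.getD i 0 : ℕ) : ZMod p) * Polynomial.X ^ i) * (Polynomial.X - Polynomial.C ((u : ℕ) : ZMod p)); let jac : (p : ℕ) → ℕ → List ℕ → ℕ → ℕ := fun p g cs u => Nat.card {w : Polynomial (ZMod p) × Polynomial (ZMod p) // w.1.Monic ∧ w.1.natDegree ≤ g ∧ w.2.degree < w.1.degree ∧ w.1 ∣ w.2 ^ 2 - F p cs u};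 let good : (p g : ℕ) → (Fin (2 * g) → Fin p) → Finset (Fin p) := fun p g c => Finset.univ.filter fun u : Fin p => Squarefree (F p (List.ofFn fun i => (c i : ℕ)) u); let ind : (p g : ℕ) → (Fin (2 * g) → Fin p) → Fin p → ℝ := fun p g c u => if 3 ∣ jac p g (List.ofFn fun i => (c i : ℕ)) u then 1 else 0; let dL : (p g : ℕ) → (Fin (2 * g) → Fin p) → ℝ := fun p g c => (∑ u ∈ good p g c, ind p g c u) / ((good p g c).card : ℝ); ∃ n₀ : ℕ, ∀ n ≥ n₀, ∀ p : ℕ, p.Prime → p.size = n → ∀ c : Fin (2 * (Nat.sqrt n / 3)) → Fin p, ∀ T : Finset (Fin n), T.card ≤ Nat.sqrt n → |∑ u ∈ good p (Nat.sqrt n / 3) c, (ind p (Nat.sqrt n / 3) c u - dL p (Nat.sqrt n / 3) c) * Literature.Probability.RandomGraphs.LowDegree.walsh T (fun i : Fin n => Nat.testBit (u : ℕ) i)| ≤ (p : ℝ) * (2 : ℝ) ^ (-((n : ℝ) / 8))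

/-- item stmt-QuantumAdvantage-16545 · support · rank 9 · open · by planner
sources: LinialMansourNisan1993, Tal2017, Green2012
[support] R2 statement: the centred indicator of 3 ∣ #J along u is o(p)-correlated with every
polynomial-size constant-depth AC⁰ circuit reading the n bits of u (uniformly over n-bit p and h).
[difficulty: M] -/
@[route_item "route-QuantumAdvantage-WeilTwice"]
def FrobOrthogonalAC0 : Prop :=
  let F : (p : ℕ) → List ℕ → ℕ → Polynomial (ZMod p) := fun p cs u => ((Polynomial.X : Polynomial (ZMod p)) ^ cs.length + ∑ i ∈ Finset.range cs.length, Polynomial.C ((cs.getD i 0 : ℕ) : ZMod p) * Polynomial.X ^ i) * (Polynomial.X - Polynomial.C ((u : ℕ) : ZMod p)); let jac : (p : ℕ) → ℕ → List ℕ → ℕ → ℕ := fun p g cs u => Nat.card {w : Polynomial (ZMod p) × Polynomial (ZMod p) // w.1.Monic ∧ w.1.natDegree ≤ g ∧ w.2.degree < w.1.degree ∧ w.1 ∣ w.2 ^ 2 - F p cs u}; let good : (p g : ℕ) → (Fin (2 * g) → Fin p) → Finset (Fin p) := fun p g c => Finset.univ.filter fun u : Fin p => Squarefree (F p (List.ofFn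 fun i => (c i : ℕ)) u); let ind : (p g : ℕ) → (Fin (2 * g) → Fin p) → Fin p → ℝ := fun p g c u => if 3 ∣ jac p g (List.ofFn fun i => (c i : ℕ)) u then 1 else 0; let dL : (p g : ℕ) → (Fin (2 * g) → Fin p) → ℝ := fun p g c => (∑ u ∈ good p g c, ind p g c u) / ((good p g c).card : ℝ); ∀ d : ℕ, ∀ q : Polynomial ℕ, ∀ ε : ℝ, 0 < ε → ∀ᶠ n : ℕ in Filter.atTop, ∀ p : ℕ, p.Prime → p.size = n → ∀ c : Fin (2 * (Nat.sqrt n / 3)) → Fin p, ∀ C : Literature.Computability.Complexity.Circuit (Fin n), C.IsOver Literature.Computability.Complexity.acBasis → C.acDepth ≤ d → C.size ≤ q.eval n → |∑ u ∈ good p (Nat.sqrt n / 3) c, (ind p (Nat.sqrt n / 3) c u - dL p (Nat.sqrt n / 3) c) * Literature.Probability.RandomGraphs.LowDegree.sgn (C.eval fun i : Fin n => Nat.testBit (u : ℕ) i)| ≤ ε * p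

/-- item stmt-QuantumAdvantage-16546 · support · rank 9 · open · by planner
sources: LinialMansourNisan1993, Tal2017, Green2012
[support] R1 ⇒ R2, PROVABLE NOW with the tree's machinery exactly as MobiusLadder.AC0Rung_proof: low
levels |S| ≤ K by `Circuit.l1Level_acBasis_le` times the 2^{−n/8} flatness, high levels by
`ACForm.tailWeight_le_tailBound`; K = polylog(n) ≤ √n. [difficulty: provable-now] -/
@[route_item "route-QuantumAdvantage-WeilTwice"]
def AcZeroRung : Prop :=
  DigitFlat → FrobOrthogonalAC0

/-- item stmt-QuantumAdvantage-16547 · support · rank 9 · open · by planner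
sources: LinialMansourNisan1993, Green2012
[support] class glue: FrobOrthogonalAC0 → LocalPriorBand → L3 ∉ AC0 (restrict a deciding circuit
family to fixed (p, h): the fixed-width encoding makes all level-n instances equal-length; a decider
has correlation 2·dens(1−dens)·#U ≥ 0.3·#U with the centred indicator, contradicting o(p)).
[difficulty: M] -/
@[route_item "route-QuantumAdvantage-WeilTwice"]
def JacThreeNotAC0 : Prop :=
  let F : (p : ℕ) → List ℕ → ℕ → Polynomial (ZMod p) := fun p cs u => ((Polynomial.X : Polynomial (ZMod p)) ^ cs.length + ∑ i ∈ Finset.range cs.length, Polynomial.C ((cs.getD i 0 : ℕ) : ZMod p) * Polynomial.X ^ i) * (Polynomial.X - Polynomial.C ((u : ℕ) : ZMod p)); let jac : (p : ℕ) → ℕ → List ℕ → ℕ → ℕ := fun p g cs u => Nat.card {w : Polynomial (ZMod p) × Polynomial (ZMod p) // w.1.Monic ∧ w.1.natDegree ≤ g ∧ w.2.degree < w.1.degree ∧ w.1 ∣ w.2 ^ 2 - F p cs u}; let Valid : ℕ × List ℕ × ℕ → Prop := fun x => x.1.Prime ∧ 5 ≤ x.1 ∧ x.2.1.length = 2 *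 (Nat.sqrt x.1.size / 3) ∧ (∀ c ∈ x.2.1, c < x.1) ∧ x.2.2 < x.1 ∧ Squarefree (F x.1 x.2.1 x.2.2); let enc : ℕ × List ℕ × ℕ → List Bool := fun x => Literature.Computability.Complexity.boolPair (Computability.encodeNat x.1) (Literature.Computability.Complexity.boolPair ((x.2.1.map fun c => List.ofFn fun i : Fin x.1.size => Nat.testBit c i).flatten) (List.ofFn fun i : Fin x.1.size => Nat.testBit x.2.2 i)); let L3 : Language Bool := enc '' {x | Valid x ∧ 3 ∣ jac x.1 (Nat.sqrt x.1.size / 3) x.2.1 x.2.2}; FrobOrthogonalAC0 → LocalPriorBand → L3 ∉ Literature.Computability.Complexity.AC0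

/-- item stmt-QuantumAdvantage-16548 · support · rank 9 · open · by planner
sources: arXiv:1211.3282, Razborov1987, Smolensky1987
[support] R3, the honest OPEN rung created by the transfer ("what breaks" (2)): the centred
indicator of 3 ∣ #J along u is o(p)-correlated with (−1)^P for every 𝔽₂-polynomial P of bounded
degree in the BITS of u — Gowers uniformity of a trace function with respect to the BOOLEAN-CUBE
structure of binary digits (XOR-shifts are not field operations for odd p; FKM arXiv:1211.3282
proves the 𝔽_p-additive version). With Razborov–Smolensky it would give L3 ∉ AC⁰[⊕]. [difficulty:
open-problem] -/
@[route_item "route-QuantumAdvantage-WeilTwice"]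
def ParityRung : Prop :=
  let F : (p : ℕ) → List ℕ → ℕ → Polynomial (ZMod p) := fun p cs u => ((Polynomial.X : Polynomial (ZMod p)) ^ cs.length + ∑ i ∈ Finset.range cs.length, Polynomial.C ((cs.getD i 0 : ℕ) : ZMod p) * Polynomial.X ^ i) * (Polynomial.X - Polynomial.C ((u : ℕ) : ZMod p)); let jac : (p : ℕ) → ℕ → List ℕ → ℕ → ℕ := fun p g cs u => Nat.card {w : Polynomial (ZMod p) × Polynomial (ZMod p) // w.1.Monic ∧ w.1.natDegree ≤ g ∧ w.2.degree < w.1.degree ∧ w.1 ∣ w.2 ^ 2 - F p cs u}; let good : (p g : ℕ) → (Fin (2 * g) → Fin p) → Finset (Fin p) := fun p g c => Finset.univ.filter fun u : Fin p => Squarefree (F p (List.ofFn fun i => (c i : ℕ)) u); let ind : (p g : ℕ) → (Fin (2 * g) → Fin p) → Fin p → ℝ := fun p g c u => if 3 ∣ jac p g (List.ofFn fun i => (c i : ℕ)) u then 1 else 0; let dL : (p g : ℕ) → (Fin (2 * g) → Fin p) → ℝ := fun p g c => (∑ u ∈ good p g c, ind p g c u) / ((good p g c).card : ℝ); ∀ d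 : ℕ, ∀ ε : ℝ, 0 < ε → ∀ᶠ n : ℕ in Filter.atTop, ∀ p : ℕ, p.Prime → p.size = n → ∀ c : Fin (2 * (Nat.sqrt n / 3)) → Fin p, ∀ P : MvPolynomial (Fin n) (ZMod 2), P.totalDegree ≤ d → |∑ u ∈ good p (Nat.sqrt n / 3) c, (ind p (Nat.sqrt n / 3) c u - dL p (Nat.sqrt n / 3) c) * (if MvPolynomial.eval (fun i : Fin n => if Nat.testBit (u : ℕ) i then (1 : ZMod 2) else 0) P = 1 then (-1 : ℝ) else 1)| ≤ ε * p

/-- item stmt-QuantumAdvantage-16549 · assembly · rank 1 · open · by planner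
sources: arXiv:math/0411623, BogdanovTrevisan2006
[assembly] JacThreeMemBQP → PriorBand → BeyondMajority → QuantumAdvantage (the installed `closes`). -/
@[route_item "route-QuantumAdvantage-WeilTwice"]
def Assembly : Prop :=
  JacThreeMemBQP → PriorBand → BeyondMajority → QuantumAdvantage

/-! D-0027 §2.1 — DECIDING THEOREM (planner-authored via `route open/edit --closes-file`; by planner-plan-novel-QuantumAdvantage-QuantumAdva-e0108269-b-v 2026-08-16T19:27:12Z):
its hypotheses are this route's items and its conclusion the sub-problem Statement (glue_lint), and it elaborates with this file. -/

@[closes "route-QuantumAdvantage-WeilTwice"] theorem closes (h₁ : JacThreeMemBQP) (h₂ : PriorBand) (h₃ : BeyondMajority) : QuantumAdvantage := by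
  refine ⟨_, h₁, fun hB => ?_⟩
  obtain ⟨A, hA, -, hcorr⟩ := Literature.Computability.Complexity.exists_randAlg_error_le_of_mem_BPP_holds hB (1 / 200) (by norm_num)
  obtain ⟨n₀, hn₀⟩ := h₂
  obtain ⟨n, hn, hle⟩ := Filter.frequently_atTop.mp (h₃ A hA) n₀
  obtain ⟨hne, hlo, hhi⟩ := hn₀ n hn
  have key : ∀ (D avg : ℝ), (1 : ℝ) / 5 - 1 / 100 ≤ D → D ≤ 1 / 2 + 1 / 100 → 1 - 1 / 200 ≤ avg →
      avg ≤ max D (1 - D) + 1 / 100 → False := by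
    intro D avg hlo hhi havg hle
    have hmax : max D (1 - D) ≤ 81 / 100 := max_le (by linarith) (by linarith)
    linarith
  refine key _ _ hlo hhi ?_ hle
  refine (le_div_iff₀ (by exact_mod_cast Finset.card_pos.mpr hne)).mpr ?_
  refine le_trans (le_of_eq ?_) (Finset.card_nsmul_le_sum _ _ (1 - 1 / 200 : ℝ) fun x _ => hcorr _)
  rw [nsmul_eq_mul, mul_comm]

end Summit.QuantumAdvantage.QuantumAdvantage.Theses.WeilTwice
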